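import Summits.KontsevichZagierPeriods.KontsevichZagierPeriods.Theorems.LinRedNormalFormArrangementNormalFormStubRebaseSimpleZeroProductBlow
import Summits.KontsevichZagierPeriods.KontsevichZagierPeriods.Theorems.LinRedNormalFormArrangementNormalFormStubRebaseOneAbove

/-!
# Stub `stub_rebaseSimpleZero`, part `rebaseSimpleZero_product` (crux `ArrangementNormalForm`, line `janus-bands`, v6.2) — `Above`

The case analysis of `stub_rebaseOne` for ONE lettered fibre `i` of a product representation over
a one-dimensional base lying ABOVE its letter `c` (`c < Uᵢ < Vᵢ` on the base cell), the other
fibres riding along as spectators; in sheared terms `Uᵢ − c = K* + A (y − p)`,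
`Vᵢ − c = K* + B (y − p)` (apex `(p, K*)` if `A ≠ B`):
* a bound parallel to the letter (`A = 0` or `B = 0`): terminal move (`RebaseZero.good_terminal`);
* THICK fibres (`Vᵢ − Uᵢ ≥ δ > 0`): Janus split at a rational level `K ≥ sup (Vᵢ − c)`
  (`RebaseZero.janus_up`, both pieces terminal);
* apex ON the letter line (`K* = 0`): blow-up to a constant interval (`RebaseZero.blow`);
* apex above the letter (`K* > 0`): Janus split AT THE APEX LEVEL (`janus_up` / `fibSplit` /
  `janus_down` according to the signs of `A`, `B`).
Every terminal piece has the fibre `i` in format and unchanged spectators, so the continuation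
hypothesis `RebaseZero.HP` finishes. Registered: `rebaseSimpleZeroProduct_above`.

References: M. Kontsevich, D. Zagier, *Periods* (2001), §1.2.
-/

noncomputable section

open Set MeasureTheory MvPolynomial
open Literature.NumberTheory.Transcendental Literature.ModelTheory.ExponentialFields

namespace Summit.KontsevichZagierPeriods.ArrangementNormalForm.JanusBands

namespace RebaseZero

open SeparatePos RebasePos

variable {k : ℕ}

/-- A product representation over an empty base cell is good. [folklore] -/
theorem good_of_cell_empty {s : KZ.IntegralRep (0 + 1 + k)} {m' : ℕ} {M : Fin m' → Cf}
    {U V : Fin k → Cf} {T : BData} {p : MvPolynomial (Fin 0) ℚ} {a : Fin k → Option Cf}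
    (h : IsProd s M U V T p a) (hI : cell M = ∅) : Good k (KZ.of s) := by
  refine good_of_mem_relations (KZ.of_mem_relations_of_volume_eq_zero s ?_)
  have : s.domain = ∅ := Set.eq_empty_of_forall_notMem fun z hz => by
    rw [h.dom, mem_pDom, hI] at hz
    exact hz.1
  rw [this, measure_empty]

/-- **A lettered fibre above its letter is good** (given the continuation hypothesis). -/
theorem good_above {s : KZ.IntegralRep (0 + 1 + k)} {m' : ℕ} {M : Fin m' → Cf} {U V : Fin k → Cf}
    {T : BData} {p : MvPolynomial (Fin 0) ℚ} {a : Fin k → Option Cf} (h : IsProd s M U V T p a)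
    (i : Fin k) (c : Cf) (ha : a i = some c) (hP : HP T i U V a)
    (hI : ∀ y ∈ cell M, ev c y < ev (U i) y ∧ ev (U i) y < ev (V i) y) : Good k (KZ.of s) := by
  set A : ℚ := (U i).1 (Fin.last 0) - c.1 (Fin.last 0) with hA
  set B : ℚ := (V i).1 (Fin.last 0) - c.1 (Fin.last 0) with hB
  set a₀ : ℚ := (U i).2 - c.2 with ha₀
  set b₀ : ℚ := (V i).2 - c.2 with hb₀
  have hUc : ∀ y : ℝ, ev (U i) y - ev c y = A * y + a₀ := fun y => by
    simp only [hA, ha₀, ev]; push_cast; ring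
  have hVc : ∀ y : ℝ, ev (V i) y - ev c y = B * y + b₀ := fun y => by
    simp only [hB, hb₀, ev]; push_cast; ring
  have hsome : ∀ c', a i = some c' → c' = c := fun c' hc' => by
    rw [ha] at hc'; exact (Option.some.inj hc').symm
  by_cases hA0 : A = 0
  · exact good_terminal h i hP fun c' hc' => by rw [hsome c' hc']; exact Or.inl (sub_eq_zero.1 hA0)
  by_cases hB0 : B = 0
  · exact good_terminal h i hP fun c' hc' => by rw [hsome c' hc']; exact Or.inr (sub_eq_zero.1 hB0)
  have hcK1 : ∀ K : ℚ, (c + mk 0 K).1 (Fin.last 0) = c.1 (Fin.last 0) := add_mk_zero_fst c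
  have hcKev : ∀ (K : ℚ) (y : ℝ), ev (c + mk 0 K) y = ev c y + K := ev_add_mk_zero c
  have jup : ∀ (K : ℚ) (lam mlo : ℝ), 0 < lam → (∀ y ∈ cell M, ev (U i) y < ev (V i) y ∧
      ev (V i) y ≤ ev c y + K ∧ 0 < mlo ∧ mlo ≤ ev (V i) y - ev c y ∧
      ev c y + K - ev (V i) y ≤ lam * (ev (V i) y - ev (U i) y)) → Good k (KZ.of s) := by
    intro K lam mlo hlam hyp
    obtain ⟨sT, sW, hT, hW, hrel⟩ := janus_up h i c ha K lam mlo hlam hyp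
    refine good_of_janus hrel ?_ ?_
    · refine good_terminal hT i (hP.transfer fun j hj => ⟨rfl, rfl, Function.update_of_ne hj _ _⟩)
        fun c' hc' => Or.inr ?_
      rw [hsome c' hc', Function.update_self, hcK1]
    · refine good_terminal hW i (hP.transfer fun j hj =>
        ⟨rfl, Function.update_of_ne hj _ _, Function.update_of_ne hj _ _⟩) fun c' hc' => Or.inr ?_
      rw [hsome c' hc', Function.update_self, hcK1]
  have jdown : ∀ (K : ℚ) (lam : ℝ), 0 < lam → 0 < K → (∀ y ∈ cell M, ev (U i) y < ev (V i) y ∧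
      ev c y + K ≤ ev (U i) y ∧ ev (U i) y - (ev c y + K) ≤ lam * (ev (V i) y - ev (U i) y)) →
      Good k (KZ.of s) := by
    intro K lam hlam hK hyp
    obtain ⟨sT, sW, hT, hW, hrel⟩ := janus_down h i c ha K lam hlam hK hyp
    refine good_of_janus hrel ?_ ?_
    · refine good_terminal hT i (hP.transfer fun j hj => ⟨rfl, Function.update_of_ne hj _ _, rfl⟩)
        fun c' hc' => Or.inl ?_
      rw [hsome c' hc', Function.update_self, hcK1]
    · refine good_terminal hW i (hP.transfer fun j hj =>
        ⟨rfl, Function.update_of_ne hj _ _, Function.update_of_ne hj _ _⟩) fun c' hc' => Or.inl ?_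
      rw [hsome c' hc', Function.update_self, hcK1]
  -- a bound on the base cell and a rational level above `Vᵢ - c`
  obtain ⟨Rb₀, hRb₀⟩ := h.cbd
  set Rb : ℝ := |Rb₀| with hRbdef
  have hRb : ∀ y ∈ cell M, |y| ≤ Rb := fun y hy => (hRb₀ y hy).trans (le_abs_self _)
  obtain ⟨Kq, hKq⟩ := exists_rat_gt (|(B : ℝ)| * Rb + |(b₀ : ℝ)|)
  have hKq0 : (0 : ℝ) < Kq := lt_of_le_of_lt (by positivity) hKq
  have hVle : ∀ y ∈ cell M, |ev (V i) y - ev c y| < Kq := fun y hy => by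
    rw [hVc]
    calc |(B : ℝ) * y + b₀| ≤ |(B : ℝ) * y| + |(b₀ : ℝ)| := abs_add_le _ _
      _ = |(B : ℝ)| * |y| + |(b₀ : ℝ)| := by rw [abs_mul]
      _ ≤ |(B : ℝ)| * Rb + |(b₀ : ℝ)| := by gcongr; exact hRb y hy
      _ < Kq := hKq
  -- THICK fibres
  have thick : ∀ δ : ℝ, 0 < δ → (∀ y ∈ cell M, δ ≤ ev (V i) y - ev (U i) y) → Good k (KZ.of s) := by
    intro δ hδ hthick
    refine jup Kq (2 * Kq / δ) δ (by positivity) fun y hy => ?_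
    obtain ⟨hcU, hUV⟩ := hI y hy
    have hV := hVle y hy
    rw [abs_lt] at hV
    refine ⟨hUV, by linarith, hδ, by linarith [hthick y hy], ?_⟩
    have : 2 * (Kq : ℝ) / δ * δ ≤ 2 * Kq / δ * (ev (V i) y - ev (U i) y) :=
      mul_le_mul_of_nonneg_left (hthick y hy) (by positivity)
    rw [div_mul_cancel₀ _ hδ.ne'] at this
    linarith
  by_cases hAB : A = B
  · rcases (cell M).eq_empty_or_nonempty with hemp | ⟨y₀, hy₀⟩
    · exact good_of_cell_empty h hemp
    refine thick (ev (V i) y₀ - ev (U i) y₀) (by linarith [(hI y₀ hy₀).2]) fun y _ => le_of_eq ?_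
    have e1 := hUc y
    have e2 := hVc y
    have e3 := hUc y₀
    have e4 := hVc y₀
    rw [hAB] at e1 e3
    linarith
  -- the apex `(p, K*)`
  set p₀ : ℚ := (a₀ - b₀) / (B - A) with hp₀
  set Ks : ℚ := A * p₀ + a₀ with hKs
  have hBA : B - A ≠ 0 := sub_ne_zero.2 (Ne.symm hAB)
  have hpq : (B - A) * p₀ = a₀ - b₀ := by rw [hp₀]; field_simp
  have hUK : ∀ y : ℝ, ev (U i) y - ev c y = Ks + A * (y - p₀) := fun y => by
    rw [hUc, hKs]; push_cast; ring
  have hVK : ∀ y : ℝ, ev (V i) y - ev c y = Ks + B * (y - p₀) := fun y => by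
    have hpr : ((B : ℝ) - A) * p₀ = a₀ - b₀ := by exact_mod_cast hpq
    rw [hVc, hKs]; push_cast; linear_combination hpr
  have hVU : ∀ y : ℝ, ev (V i) y - ev (U i) y = ((B : ℝ) - A) * (y - p₀) := fun y => by
    have e1 := hUK y; have e2 := hVK y
    have : ((B : ℝ) - A) * (y - p₀) = (Ks + B * (y - p₀)) - (Ks + A * (y - p₀)) := by ring
    linarith
  have hw : ∀ y ∈ cell M, 0 < ((B : ℝ) - A) * (y - p₀) := fun y hy => by
    rw [← hVU]; linarith [(hI y hy).2]
  have hA' : (A : ℝ) ≠ 0 := by exact_mod_cast hA0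
  have hBA' : (B : ℝ) - A ≠ 0 := by exact_mod_cast hBA
  rcases lt_trichotomy Ks 0 with hKneg | hK0 | hKpos
  · -- apex below the letter: thick
    have hKn : (0 : ℝ) < -(Ks : ℝ) := by exact_mod_cast neg_pos.2 hKneg
    refine thick (|(B : ℝ) - A| * (-(Ks : ℝ) / |(A : ℝ)|)) (by positivity) fun y hy => ?_
    obtain ⟨hcU, hUV⟩ := hI y hy
    have hu : 0 < (Ks : ℝ) + A * (y - p₀) := by rw [← hUK]; linarith
    have hAp : (0 : ℝ) < |(A : ℝ)| := abs_pos.2 hA'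
    have h1 : -(Ks : ℝ) < |(A : ℝ)| * |(y : ℝ) - p₀| := by
      rw [← abs_mul]; exact lt_of_lt_of_le (by linarith) (le_abs_self _)
    have h2 : -(Ks : ℝ) / |(A : ℝ)| < |(y : ℝ) - p₀| := by rwa [div_lt_iff₀ hAp, mul_comm]
    rw [hVU, show ((B : ℝ) - A) * (y - p₀) = |(B : ℝ) - A| * |(y : ℝ) - p₀| by
      rw [← abs_mul]; exact (abs_of_pos (hw y hy)).symm]
    exact mul_le_mul_of_nonneg_left h2.le (abs_nonneg _)
  · -- apex on the letter line: blow up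
    set ε : ℚ := if 0 < B - A then 1 else -1 with hε
    have hε1 : ε = 1 ∨ ε = -1 := by rw [hε]; split_ifs <;> simp
    have hεw : ∀ y ∈ cell M, 0 < (ε : ℝ) * (y - p₀) := fun y hy => by
      have hst := RebaseOne.sign_transfer 1 (hw y hy)
      rw [hε]
      split_ifs with hs
      · have hs' : (0 : ℝ) < 1 * (B - A) := by rw [one_mul]; exact_mod_cast hs
        simpa using hst.1 hs'
      · have hs' : (1 : ℝ) * (B - A) < 0 := by
          rw [one_mul]; exact_mod_cast lt_of_le_of_ne (not_lt.1 hs) hBA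
        have := hst.2 hs'
        push_cast; linarith
    obtain ⟨s', h', hrel⟩ := blow h i c ha p₀ A B ε hε1 (fun y hy => ⟨hεw y hy, (hI y hy).2⟩)
      (fun y => by have := hUK y; rw [hK0] at this; push_cast at this; linarith)
      (fun y => by have := hVK y; rw [hK0] at this; push_cast at this; linarith)
    refine good_of_sub_mem hrel (hP _ s' M _ _ _ _ h' ⟨fun c' hc' => ?_, Or.inl ?_, Or.inl ?_⟩
      (same_update i U V a _ _ _))
    · simp only [Function.update_self, Option.some.injEq] at hc'
      rw [← hc']; rfl
    · rw [Function.update_self]; rfl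
    · rw [Function.update_self]; rfl
  · -- apex above the letter: Janus split at the apex level
    have hKs' : (0 : ℝ) < Ks := by exact_mod_cast hKpos
    rcases lt_or_gt_of_ne (mul_ne_zero hA0 hBA : A * (B - A) ≠ 0) with hAs | hAs
    · have hAw : ∀ y ∈ cell M, (A : ℝ) * (y - p₀) < 0 := fun y hy =>
        (RebaseOne.sign_transfer (A : ℝ) (hw y hy)).2 (by exact_mod_cast hAs)
      rcases lt_or_gt_of_ne (mul_ne_zero hB0 hBA : B * (B - A) ≠ 0) with hBs | hBs
      · -- nested above: extend by the wedge `{Vᵢ < tᵢ < c + K*}`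
        have hBw : ∀ y ∈ cell M, (B : ℝ) * (y - p₀) < 0 := fun y hy =>
          (RebaseOne.sign_transfer (B : ℝ) (hw y hy)).2 (by exact_mod_cast hBs)
        set q : ℝ := (B : ℝ) / A with hq
        refine jup Ks (-(B : ℝ) / (B - A)) ((Ks : ℝ) * (1 - q)) ?_ fun y hy => ?_
        · have : -(B : ℝ) / (B - A) = -((B : ℝ) * (B - A)) / (B - A) ^ 2 := by field_simp
          rw [this]
          exact div_pos (by exact_mod_cast neg_pos.2 hBs) (by positivity)
        · obtain ⟨hcU, hUV⟩ := hI y hy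
          have eU := hUK y
          have eV := hVK y
          have hBy := hBw y hy
          have hAy := hAw y hy
          have hAB2 : (A : ℝ) * (y - p₀) < B * (y - p₀) := by linarith
          have hu : 0 < (Ks : ℝ) + A * (y - p₀) := by linarith
          have hqw : q * ((A : ℝ) * (y - p₀)) = B * (y - p₀) := by rw [hq]; field_simp
          have hq0 : 0 < q := by nlinarith
          have hq1 : q < 1 := by nlinarith
          refine ⟨hUV, by linarith, mul_pos hKs' (by linarith), ?_, ?_⟩
          · have : (Ks : ℝ) + B * (y - p₀) - Ks * (1 - q) = q * (Ks + A * (y - p₀)) := by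
              linear_combination (-1 : ℝ) * hqw
            nlinarith [mul_pos hq0 hu]
          · rw [hVU]
            have : -(B : ℝ) / (B - A) * ((B - A) * (y - p₀)) = -(B * (y - p₀)) := by field_simp
            rw [this]
            linarith
      · -- partition at the apex level
        have hBw : ∀ y ∈ cell M, 0 < (B : ℝ) * (y - p₀) := fun y hy =>
          (RebaseOne.sign_transfer (B : ℝ) (hw y hy)).1 (by exact_mod_cast hBs)
        have key : ∀ y ∈ cell M, ev (U i) y < ev (c + mk 0 Ks) y ∧ ev (c + mk 0 Ks) y < ev (V i) y :=
          fun y hy => by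
            rw [hcKev]
            constructor <;> linarith [hUK y, hVK y, hAw y hy, hBw y hy]
        refine fibSplit h i (c + mk 0 Ks) (fun y hy => ⟨(key y hy).1.le, (key y hy).2.le⟩)
          (fun s₁ h₁ => ?_) (fun s₂ h₂ => ?_)
        · refine good_terminal h₁ i (hP.transfer fun j hj => ⟨rfl, rfl, Function.update_of_ne hj _ _⟩)
            fun c' hc' => Or.inr ?_
          rw [hsome c' hc', Function.update_self, hcK1]
        · refine good_terminal h₂ i (hP.transfer fun j hj => ⟨rfl, Function.update_of_ne hj _ _, rfl⟩)
            fun c' hc' => Or.inl ?_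
          rw [hsome c' hc', Function.update_self, hcK1]
    · -- nested below: extend by the wedge `{c + K* < tᵢ < Uᵢ}`
      have hAw : ∀ y ∈ cell M, 0 < (A : ℝ) * (y - p₀) := fun y hy =>
        (RebaseOne.sign_transfer (A : ℝ) (hw y hy)).1 (by exact_mod_cast hAs)
      refine jdown Ks ((A : ℝ) / (B - A)) ?_ hKpos fun y hy => ?_
      · have : (A : ℝ) / (B - A) = ((A : ℝ) * (B - A)) / (B - A) ^ 2 := by field_simp
        rw [this]
        exact div_pos (by exact_mod_cast hAs) (by positivity)
      · obtain ⟨hcU, hUV⟩ := hI y hy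
        refine ⟨hUV, by linarith [hUK y, hAw y hy], ?_⟩
        rw [hVU]
        have : (A : ℝ) / (B - A) * ((B - A) * (y - p₀)) = A * (y - p₀) := by field_simp
        rw [this]
        linarith [hUK y]

end RebaseZero

/-- Registered support goal of this file: a lettered fibre of a product representation lying
above its letter is good, given the continuation hypothesis (`RebaseZero.good_above`). -/
theorem rebaseSimpleZeroProduct_above (k m' : ℕ) (s : KZ.IntegralRep (0 + 1 + k)) (M : Fin m' → (Fin (0 + 1) → ℚ) × ℚ) (U V : Fin k → (Fin (0 + 1) → ℚ) × ℚ) (T : RebaseZero.BData) (p : MvPolynomial (Fin 0) ℚ) (a : Fin k → Option ((Fin (0 + 1) → ℚ) × ℚ)) (h : RebaseZero.IsProd s M U V T p a) (i : Fin k) (c : (Fin (0 + 1) → ℚ) × ℚ) (ha : a i = some c) (hP : RebaseZero.HP T i U V a) (hI : ∀ y ∈ RebaseZero.cell M, RebaseZero.ev c y < RebaseZero.ev (U i) y ∧ RebaseZero.ev (U i) y < RebaseZero.ev (V i) y) : RebaseZero.Good k (KZ.of s) :=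
  RebaseZero.good_above h i c ha hP hI

end Summit.KontsevichZagierPeriods.ArrangementNormalForm.JanusBands
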